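import Literature.MathematicalPhysics.QuantumLattice.HubbardGridCharacters
import Literature.MathematicalPhysics.QuantumLattice.HubbardSectorGridOverlapReindex
import HarnessLib

/-!
# WEIGHTED row and column sums of the grid propagator and of the cross-grid overlap kernel are weighted product-torus sums

Topic `MathematicalPhysics/QuantumLattice`; the decay-weighted twins of `HubbardGridCharacters.sum_norm_gridSub_pullback_row_le/col_le`
(grid propagator `Sᵀ C S` on the `N`-point time grid) and of `HubbardSectorGridOverlapReindex.rowSum_/colSum_sectorAnalysis_mul_hubbardGridSub_le_of_torusSum`
(overlap kernel `E_F S_{4M}`).  The decay-weighted single-scale step (`GrassmannWeightedEffectiveActionBiGradedMap`) reads its covariance and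
its analysis map through PAIR-WEIGHTED row and column sums `Σ_Y ‖C(X,Y)‖·w(X,Y)` with a weight that is a function of the DIFFERENCE of the
two space-time points (`1 + |x - y|`, Benfatto–Giuliani–Mastropietro 2006, §3 (3.2)–(3.8)); by the translation invariance of both kernels
(the entries are character sums of the zero-padded symbol at the difference point) these are the correspondingly weighted `ℓ¹` norms of ONE
character sum on the product torus `(ℤ/N) × (ℤ/L)²`:

* **`sum_norm_mul_gridSub_pullback_row_le_of_weight`**, **`…_col_le_of_weight`** — for an even weight `φ(a, b)` on the product torus, if
  `Σ_{(a,b)} φ(a,b)·‖Σ_q χ_q(a,b) G_σ(q)‖ ≤ A` for both spins then `Σ_Y ‖(Sᵀ C S)(X,Y)‖·φ(j_X - j_Y, x⃗_X - x⃗_Y) ≤ A` for every grid leg `X`,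
  and the same for columns;
* **`rowSum_mul_sectorAnalysis_mul_hubbardGridSub_le_of_weight`**, **`colSum_mul_…_le_of_weight`** — for a weight `ψ(d, w)` on
  `(ℤ/4M) × (ℤ/L)²`, if `(|β|L²)⁻¹ Σ_{(d,w)} ψ(d,w)·‖Σ_k F_ω(k) Χ_c(k; d, w)‖ ≤ T` for every sector and charge, then the rows of `E_F S_{4M}`
  weighted by `ψ(q₀ - 2y₀, q⃗ - y⃗)` sum to `≤ T` and the columns to `≤ N_sectors·T`.

Used by the first-moment bound (E4)₀ of the K3 engine of the cell gate-hubbard-kl (weight `1 + (β/N)|Δt|_N + |Δx⃗|_L`).  Everything is proved;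
no definitions, no named facts.

## Sources

G. Benfatto, A. Giuliani, V. Mastropietro, Ann. Henri Poincaré 7 (2006) 809–898, §2.1 (2.3)–(2.5), §2.7 (2.70)–(2.71a), Lemma 2.2, §3 (3.2)–(3.8)
(`BenfattoGiulianiMastropietro2006`); M. Salmhofer, *Renormalization* (1999), §4.2.4 (4.55)–(4.63) (`Salmhofer1999`).
-/

noncomputable section

namespace Literature.MathematicalPhysics.QuantumLattice

open Finset Complex Literature.Probability.LatticeModels GrassmannAlgebra
open scoped Real ComplexConjugate

variable {L M N : ℕ} [NeZero L] [NeZero N]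

/-! ### The grid propagator `Sᵀ C S` -/

/-- **Weighted row sums of the grid covariance are weighted `ℓ¹` norms of the character sums**: for a weight `φ` on the product torus
that is EVEN (`φ(-a,-b) = φ(a,b)`), if `Σ_{(a,b)} φ(a,b)·‖Σ_q χ_q(a,b) G_σ(q)‖ ≤ A` for both spins, then
`Σ_{Y} ‖(Sᵀ C S)(X, Y)‖·φ(j_X - j_Y, x⃗_X - x⃗_Y) ≤ A` for every grid leg `X` (`2M ≤ N`, `β ≠ 0`).
[cite: BenfattoGiulianiMastropietro2006, Lemma 2.2 and §3 (3.2)–(3.8)] -/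
theorem sum_norm_mul_gridSub_pullback_row_le_of_weight {β : ℝ} (hβ : β ≠ 0) (hN : 2 * M ≤ N) (p : FreqMomentum L M × Fin 2 → ℂ)
    (φ : TorusSite 1 N → TorusSite 2 L → ℝ) (hφ : ∀ a bv, φ (-a) (-bv) = φ a bv)
    {A : ℝ} (hA : ∀ σ : Fin 2, ∑ a : TorusSite 1 N, ∑ bv : TorusSite 2 L,
      φ a bv * ‖∑ q₀ : TorusSite 1 N, ∑ qv : TorusSite 2 L, torusChar q₀ a * torusChar qv bv * gridSymbol L M N β p σ q₀ qv‖ ≤ A)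
    (X : GridLeg (GridPoint L N)) :
    ∑ Y : GridLeg (GridPoint L N), ‖((hubbardGridSub L M β N).transpose * normalCovariance L M p * hubbardGridSub L M β N) X Y‖ *
        φ (fun _ : Fin 1 => ((X.1.1.1 : ℕ) : ZMod N) - ((Y.1.1.1 : ℕ) : ZMod N)) (X.1.1.2 - Y.1.1.2) ≤ A := by
  obtain ⟨⟨⟨j, x⟩, σ⟩, c⟩ := X
  set C' := (hubbardGridSub L M β N).transpose * normalCovariance L M p * hubbardGridSub L M β N with hC'
  have hzero : ∀ Y : GridLeg (GridPoint L N), (Y.2 = c ∨ Y.1.2 ≠ σ) → C' (((j, x), σ), c) Y = 0 := by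
    rintro Y (hc | hs)
    · exact gridSub_pullback_normalCovariance_apply_of_charge_eq β _ _ p (Y := (((j, x), σ), c)) (Y' := Y) hc.symm
    · exact gridSub_pullback_normalCovariance_apply_of_spin_ne β _ _ p (Y := (((j, x), σ), c)) (Y' := Y) (Ne.symm hs)
  -- only the legs `((b, σ), 1 - c)` contribute
  have hsum : ∑ Y : GridLeg (GridPoint L N), ‖C' (((j, x), σ), c) Y‖ *
        φ (fun _ : Fin 1 => ((j : ℕ) : ZMod N) - ((Y.1.1.1 : ℕ) : ZMod N)) (x - Y.1.1.2) =
      ∑ b : GridPoint L N, ‖C' (((j, x), σ), c) ((b, σ), if c = 0 then 1 else 0)‖ *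
        φ (fun _ : Fin 1 => ((j : ℕ) : ZMod N) - ((b.1 : ℕ) : ZMod N)) (x - b.2) := by
    rw [Fintype.sum_prod_type, Fintype.sum_prod_type]
    refine sum_congr rfl fun b _ => ?_
    rw [Fintype.sum_eq_single σ fun σ' hσ' => ?_, Fintype.sum_eq_single (if c = 0 then (1 : Fin 2) else 0) fun c' hc' => ?_]
    · rw [hzero ((b, σ), c') (Or.inl ?_), norm_zero, zero_mul]
      fin_cases c <;> fin_cases c' <;> simp_all
    · exact sum_eq_zero fun c' _ => by rw [hzero ((b, σ'), c') (Or.inr hσ'), norm_zero, zero_mul]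
  rw [hsum]
  fin_cases c
  · -- charge `0`: the `(+,-)` orientation
    simp only [Fin.zero_eta, Fin.isValue, if_true]
    calc ∑ b : GridPoint L N, ‖C' (((j, x), σ), 0) ((b, σ), 1)‖ * φ (fun _ : Fin 1 => ((j : ℕ) : ZMod N) - ((b.1 : ℕ) : ZMod N)) (x - b.2)
        = ∑ b : GridPoint L N, (φ (fun _ : Fin 1 => ((j : ℕ) : ZMod N) - ((b.1 : ℕ) : ZMod N)) (x - b.2) *
            ‖∑ q₀ : TorusSite 1 N, ∑ qv : TorusSite 2 L,
              torusChar q₀ (fun _ : Fin 1 => ((j : ℕ) : ZMod N) - ((b.1 : ℕ) : ZMod N)) * torusChar qv (x - b.2) *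
                gridSymbol L M N β p σ q₀ qv‖) := sum_congr rfl fun b _ => by
          rw [hC', norm_gridSub_pullback_apply_zero_one_eq hβ hN p j b.1 x b.2 σ, mul_comm]
      _ = ∑ a : TorusSite 1 N, ∑ bv : TorusSite 2 L, φ a bv * ‖∑ q₀ : TorusSite 1 N, ∑ qv : TorusSite 2 L,
            torusChar q₀ a * torusChar qv bv * gridSymbol L M N β p σ q₀ qv‖ :=
          sum_gridPoint_eq_sum_prodTorus (fun a bv => φ a bv * ‖∑ q₀ : TorusSite 1 N, ∑ qv : TorusSite 2 L,
            torusChar q₀ a * torusChar qv bv * gridSymbol L M N β p σ q₀ qv‖) j x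
      _ ≤ A := hA σ
  · -- charge `1`: the `(-,+)` orientation, by antisymmetry and evenness of the weight
    simp only [Fin.mk_one, Fin.isValue, one_ne_zero, if_false]
    calc ∑ b : GridPoint L N, ‖C' (((j, x), σ), 1) ((b, σ), 0)‖ * φ (fun _ : Fin 1 => ((j : ℕ) : ZMod N) - ((b.1 : ℕ) : ZMod N)) (x - b.2)
        = ∑ b : GridPoint L N, (φ (fun _ : Fin 1 => ((j : ℕ) : ZMod N) - ((b.1 : ℕ) : ZMod N)) (x - b.2) *
            ‖∑ q₀ : TorusSite 1 N, ∑ qv : TorusSite 2 L,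
              torusChar q₀ (fun _ : Fin 1 => ((b.1 : ℕ) : ZMod N) - ((j : ℕ) : ZMod N)) * torusChar qv (b.2 - x) *
                gridSymbol L M N β p σ q₀ qv‖) := sum_congr rfl fun b _ => by
          have h01 := norm_gridSub_pullback_apply_zero_one_eq hβ hN p b.1 j b.2 x σ
          rw [hubbardGridSub] at h01
          rw [hC', hubbardGridSub, gridSub_pullback_normalCovariance_apply_one_zero, norm_neg, mul_comm]
          rw [h01]
      _ = ∑ a : TorusSite 1 N, ∑ bv : TorusSite 2 L, φ a bv * ‖∑ q₀ : TorusSite 1 N, ∑ qv : TorusSite 2 L,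
            torusChar q₀ (-a) * torusChar qv (-bv) * gridSymbol L M N β p σ q₀ qv‖ := by
          rw [← sum_gridPoint_eq_sum_prodTorus (fun a bv => φ a bv * ‖∑ q₀ : TorusSite 1 N, ∑ qv : TorusSite 2 L,
            torusChar q₀ (-a) * torusChar qv (-bv) * gridSymbol L M N β p σ q₀ qv‖) j x]
          refine sum_congr rfl fun b _ => ?_
          rw [show -(fun _ : Fin 1 => ((j : ℕ) : ZMod N) - ((b.1 : ℕ) : ZMod N)) =
              fun _ : Fin 1 => ((b.1 : ℕ) : ZMod N) - ((j : ℕ) : ZMod N) from funext fun _ => by simp [neg_sub], neg_sub]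
      _ = ∑ a : TorusSite 1 N, ∑ bv : TorusSite 2 L, φ a bv * ‖∑ q₀ : TorusSite 1 N, ∑ qv : TorusSite 2 L,
            torusChar q₀ a * torusChar qv bv * gridSymbol L M N β p σ q₀ qv‖ := by
          rw [← Fintype.sum_prod_type', ← Fintype.sum_prod_type']
          refine Fintype.sum_equiv (Equiv.neg _) _ _ fun ab => ?_
          simp only [Equiv.neg_apply, Prod.fst_neg, Prod.snd_neg, hφ]
      _ ≤ A := hA σ

/-- **Weighted column sums are at most the same constant** (the pulled-back covariance is antisymmetric, the weight symmetric in the sense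
`φ(-a,-b) = φ(a,b)`). [cite: BenfattoGiulianiMastropietro2006, Lemma 2.2 and §3 (3.2)–(3.8)] -/
theorem sum_norm_mul_gridSub_pullback_col_le_of_weight {β : ℝ} (hβ : β ≠ 0) (hN : 2 * M ≤ N) (p : FreqMomentum L M × Fin 2 → ℂ)
    (φ : TorusSite 1 N → TorusSite 2 L → ℝ) (hφ : ∀ a bv, φ (-a) (-bv) = φ a bv)
    {A : ℝ} (hA : ∀ σ : Fin 2, ∑ a : TorusSite 1 N, ∑ bv : TorusSite 2 L,
      φ a bv * ‖∑ q₀ : TorusSite 1 N, ∑ qv : TorusSite 2 L, torusChar q₀ a * torusChar qv bv * gridSymbol L M N β p σ q₀ qv‖ ≤ A)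
    (Y : GridLeg (GridPoint L N)) :
    ∑ X : GridLeg (GridPoint L N), ‖((hubbardGridSub L M β N).transpose * normalCovariance L M p * hubbardGridSub L M β N) X Y‖ *
        φ (fun _ : Fin 1 => ((X.1.1.1 : ℕ) : ZMod N) - ((Y.1.1.1 : ℕ) : ZMod N)) (X.1.1.2 - Y.1.1.2) ≤ A := by
  refine le_of_eq_of_le (sum_congr rfl fun X _ => ?_) (sum_norm_mul_gridSub_pullback_row_le_of_weight hβ hN p φ hφ hA Y)
  have h := congrFun (congrFun (gridSub_pullback_normalCovariance_transpose β (fun q : GridPoint L N => q.2)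
    (fun q => gridTime β N q.1) p) Y) X
  rw [Matrix.transpose_apply, Matrix.neg_apply] at h
  rw [hubbardGridSub, h, norm_neg]
  congr 1
  rw [← hφ, neg_sub]
  congr 1
  funext l
  simp [neg_sub]

/-! ### The cross-grid overlap kernel `E_F S_{4M}` -/

/-- **Weighted row sums of `E_F S_{4M}` from ONE weighted product-torus bound**: if for every sector `ω` and charge `c`
`(|β|L²)⁻¹ Σ_{(d,w)} ψ(d,w)·‖Σ_k F_ω(k) Χ_c(k; d, w)‖ ≤ T`, then every row of `E_F S_{4M}`, weighted by `ψ(q₀ - 2y₀, q⃗ - y⃗)`, sums to `≤ T`.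
[cite: BenfattoGiulianiMastropietro2006, §2.7 (2.71a) and §3 (3.2)–(3.8)] -/
theorem rowSum_mul_sectorAnalysis_mul_hubbardGridSub_le_of_weight {Ns : ℕ} [NeZero M] {β : ℝ} (hβ : β ≠ 0)
    (F : Fin Ns → FreqMomentum L M → ℂ) (ψ : TorusSite 1 (2 * (2 * M)) → TorusSite 2 L → ℝ) {T : ℝ}
    (hT : ∀ (ω : Fin Ns) (c : Fin 2), 1 / (|β| * (L : ℝ) ^ 2) *
        ∑ dw : TorusSite 1 (2 * (2 * M)) × TorusSite 2 L, ψ dw.1 dw.2 * ‖∑ k : FreqMomentum L M, F ω k *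
          (if c = 0 then torusChar (fun _ : Fin 1 => ((k.1 : ℕ) : ZMod (2 * (2 * M)))) dw.1 * torusChar k.2 dw.2
            else conj (torusChar (fun _ : Fin 1 => ((k.1 : ℕ) : ZMod (2 * (2 * M)))) dw.1 * torusChar k.2 dw.2))‖ ≤ T)
    (ω : Fin Ns) (σ c : Fin 2) (y : SpaceTimeIdx L M) :
    ∑ q : GridPoint L (2 * (2 * M)),
      ‖(sectorAnalysisMatrix L M β F * hubbardGridSub L M β (2 * (2 * M))) (y, ((ω, σ), c)) ((q, σ), c)‖ *
        ψ (fun _ : Fin 1 => ((q.1 : ℕ) : ZMod (2 * (2 * M))) - 2 * ((y.1 : ℕ) : ZMod (2 * (2 * M)))) (q.2 - y.2) ≤ T := by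
  haveI : NeZero (2 * (2 * M)) := ⟨by have := NeZero.ne M; omega⟩
  refine le_trans (le_of_eq ?_) (hT ω c)
  simp_rw [norm_sectorAnalysis_mul_hubbardGridSub_apply hβ]
  rw [mul_sum]
  simp_rw [mul_assoc, ← mul_sum]
  rw [show ∑ q : GridPoint L (2 * (2 * M)), ‖∑ k : FreqMomentum L M, F ω k *
        (if c = 0 then torusChar (fun _ : Fin 1 => ((k.1 : ℕ) : ZMod (2 * (2 * M))))
            (fun _ : Fin 1 => ((q.1 : ℕ) : ZMod (2 * (2 * M))) - 2 * ((y.1 : ℕ) : ZMod (2 * (2 * M)))) * torusChar k.2 (q.2 - y.2)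
          else conj (torusChar (fun _ : Fin 1 => ((k.1 : ℕ) : ZMod (2 * (2 * M))))
            (fun _ : Fin 1 => ((q.1 : ℕ) : ZMod (2 * (2 * M))) - 2 * ((y.1 : ℕ) : ZMod (2 * (2 * M)))) * torusChar k.2 (q.2 - y.2)))‖ *
        ψ (fun _ : Fin 1 => ((q.1 : ℕ) : ZMod (2 * (2 * M))) - 2 * ((y.1 : ℕ) : ZMod (2 * (2 * M)))) (q.2 - y.2) =
      ∑ dw : TorusSite 1 (2 * (2 * M)) × TorusSite 2 L, ψ dw.1 dw.2 * ‖∑ k : FreqMomentum L M, F ω k *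
        (if c = 0 then torusChar (fun _ : Fin 1 => ((k.1 : ℕ) : ZMod (2 * (2 * M)))) dw.1 * torusChar k.2 dw.2
          else conj (torusChar (fun _ : Fin 1 => ((k.1 : ℕ) : ZMod (2 * (2 * M)))) dw.1 * torusChar k.2 dw.2))‖ from ?_]
  -- `q ↦ (q₀ - 2y₀, q⃗ - y⃗)` is a bijection onto the product torus
  refine Fintype.sum_bijective (fun q : GridPoint L (2 * (2 * M)) =>
      ((fun _ : Fin 1 => ((q.1 : ℕ) : ZMod (2 * (2 * M))) - 2 * ((y.1 : ℕ) : ZMod (2 * (2 * M))), q.2 - y.2) :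
        TorusSite 1 (2 * (2 * M)) × TorusSite 2 L)) ?_ _ _ fun _ => by rw [mul_comm]
  refine (Fintype.bijective_iff_injective_and_card _).2 ⟨fun q q' hqq => ?_, ?_⟩
  · have h1 := congr_fun (congr_arg Prod.fst hqq) 0
    have h2 := congr_arg Prod.snd hqq
    simp only [sub_left_inj] at h1 h2
    refine Prod.ext ?_ h2
    have hv := congr_arg ZMod.val h1
    rw [ZMod.val_natCast, ZMod.val_natCast, Nat.mod_eq_of_lt q.1.isLt, Nat.mod_eq_of_lt q'.1.isLt] at hv
    exact Fin.ext hv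
  · simp only [Fintype.card_prod, Fintype.card_fin, Fintype.card_pi, Fin.prod_const, ZMod.card, pow_one]

/-- **Weighted column sums of `E_F S_{4M}`**: under the same bound (with `ψ ≥ 0`), every column weighted by `ψ(q₀ - 2y₀, q⃗ - y⃗)` and summed
over the rows of all sectors is `≤ N_sectors · T`. [cite: BenfattoGiulianiMastropietro2006, §2.7 (2.71a) and §3 (3.2)–(3.8)] -/
theorem colSum_mul_sectorAnalysis_mul_hubbardGridSub_le_of_weight {Ns : ℕ} [NeZero M] {β : ℝ} (hβ : β ≠ 0)
    (F : Fin Ns → FreqMomentum L M → ℂ) (ψ : TorusSite 1 (2 * (2 * M)) → TorusSite 2 L → ℝ) (hψ : ∀ d w, 0 ≤ ψ d w) {T : ℝ}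
    (hT : ∀ (ω : Fin Ns) (c : Fin 2), 1 / (|β| * (L : ℝ) ^ 2) *
        ∑ dw : TorusSite 1 (2 * (2 * M)) × TorusSite 2 L, ψ dw.1 dw.2 * ‖∑ k : FreqMomentum L M, F ω k *
          (if c = 0 then torusChar (fun _ : Fin 1 => ((k.1 : ℕ) : ZMod (2 * (2 * M)))) dw.1 * torusChar k.2 dw.2
            else conj (torusChar (fun _ : Fin 1 => ((k.1 : ℕ) : ZMod (2 * (2 * M)))) dw.1 * torusChar k.2 dw.2))‖ ≤ T)
    (σ c : Fin 2) (q : GridPoint L (2 * (2 * M))) :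
    ∑ ω : Fin Ns, ∑ y : SpaceTimeIdx L M,
      ‖(sectorAnalysisMatrix L M β F * hubbardGridSub L M β (2 * (2 * M))) (y, ((ω, σ), c)) ((q, σ), c)‖ *
        ψ (fun _ : Fin 1 => ((q.1 : ℕ) : ZMod (2 * (2 * M))) - 2 * ((y.1 : ℕ) : ZMod (2 * (2 * M)))) (q.2 - y.2) ≤ Ns * T := by
  classical
  haveI : NeZero (2 * (2 * M)) := ⟨by have := NeZero.ne M; omega⟩
  have hcol : ∀ ω : Fin Ns, ∑ y : SpaceTimeIdx L M,
      ‖(sectorAnalysisMatrix L M β F * hubbardGridSub L M β (2 * (2 * M))) (y, ((ω, σ), c)) ((q, σ), c)‖ *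
        ψ (fun _ : Fin 1 => ((q.1 : ℕ) : ZMod (2 * (2 * M))) - 2 * ((y.1 : ℕ) : ZMod (2 * (2 * M)))) (q.2 - y.2) ≤ T := by
    intro ω
    refine le_trans ?_ (hT ω c)
    simp_rw [norm_sectorAnalysis_mul_hubbardGridSub_apply hβ]
    rw [mul_sum]
    simp_rw [mul_assoc, ← mul_sum]
    refine mul_le_mul_of_nonneg_left ?_ (by positivity)
    -- `y ↦ (q₀ - 2y₀, q⃗ - y⃗)` is injective
    set g : SpaceTimeIdx L M → TorusSite 1 (2 * (2 * M)) × TorusSite 2 L := fun y =>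
      ((fun _ : Fin 1 => ((q.1 : ℕ) : ZMod (2 * (2 * M))) - 2 * ((y.1 : ℕ) : ZMod (2 * (2 * M))), q.2 - y.2)) with hg
    set f : TorusSite 1 (2 * (2 * M)) × TorusSite 2 L → ℝ := fun dw => ψ dw.1 dw.2 * ‖∑ k : FreqMomentum L M, F ω k *
      (if c = 0 then torusChar (fun _ : Fin 1 => ((k.1 : ℕ) : ZMod (2 * (2 * M)))) dw.1 * torusChar k.2 dw.2
        else conj (torusChar (fun _ : Fin 1 => ((k.1 : ℕ) : ZMod (2 * (2 * M)))) dw.1 * torusChar k.2 dw.2))‖ with hf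
    have hf0 : ∀ dw, 0 ≤ f dw := fun dw => mul_nonneg (hψ _ _) (norm_nonneg _)
    have hinj : Function.Injective g := by
      intro y y' hyy
      have h1 := congr_fun (congr_arg Prod.fst hyy) 0
      have h2 := congr_arg Prod.snd hyy
      simp only [hg, sub_right_inj] at h1 h2
      refine Prod.ext ?_ h2
      have hv := congr_arg ZMod.val h1
      have hy : 2 * (y.1 : ℕ) < 2 * (2 * M) := by have := y.1.isLt; omega
      have hy' : 2 * (y'.1 : ℕ) < 2 * (2 * M) := by have := y'.1.isLt; omega
      have e1 : (2 * ((y.1 : ℕ) : ZMod (2 * (2 * M)))).val = 2 * (y.1 : ℕ) := by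
        rw [show (2 : ZMod (2 * (2 * M))) * ((y.1 : ℕ) : ZMod (2 * (2 * M))) = ((2 * (y.1 : ℕ) : ℕ) : ZMod (2 * (2 * M))) by push_cast; rfl,
          ZMod.val_natCast, Nat.mod_eq_of_lt hy]
      have e2 : (2 * ((y'.1 : ℕ) : ZMod (2 * (2 * M)))).val = 2 * (y'.1 : ℕ) := by
        rw [show (2 : ZMod (2 * (2 * M))) * ((y'.1 : ℕ) : ZMod (2 * (2 * M))) = ((2 * (y'.1 : ℕ) : ℕ) : ZMod (2 * (2 * M))) by push_cast; rfl,
          ZMod.val_natCast, Nat.mod_eq_of_lt hy']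
      rw [e1, e2] at hv
      exact Fin.ext (by omega)
    calc ∑ y : SpaceTimeIdx L M, ‖∑ k : FreqMomentum L M, F ω k *
            (if c = 0 then torusChar (fun _ : Fin 1 => ((k.1 : ℕ) : ZMod (2 * (2 * M)))) (g y).1 * torusChar k.2 (g y).2
              else conj (torusChar (fun _ : Fin 1 => ((k.1 : ℕ) : ZMod (2 * (2 * M)))) (g y).1 * torusChar k.2 (g y).2))‖ *
            ψ (g y).1 (g y).2
        = ∑ y : SpaceTimeIdx L M, f (g y) := sum_congr rfl fun y _ => by rw [hf, mul_comm]
      _ = ∑ dw ∈ univ.image g, f dw := by rw [sum_image fun y _ y' _ h => hinj h]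
      _ ≤ ∑ dw, f dw := sum_le_sum_of_subset_of_nonneg (subset_univ _) fun _ _ _ => hf0 _
  calc _ ≤ ∑ _ω : Fin Ns, T := sum_le_sum fun ω _ => hcol ω
    _ = Ns * T := by rw [sum_const, card_univ, Fintype.card_fin, nsmul_eq_mul]

end Literature.MathematicalPhysics.QuantumLattice

end
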